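import Summits.CriticalPhenomena.PercolationContinuityZ3.Theses.PercNearOneGluing
import Literature.Probability.Percolation.PercolationEvents
import HarnessLib.Audit

/-! TTRL-lite variant V2522 of stmt-CriticalPhenomena-4574 -/

namespace Summit.CriticalPhenomena.PercolationContinuityZ3.Theorems

open MeasureTheory Set Literature.Probability.LatticeModels Literature.Probability.Percolation
open scoped Classical BigOperators

/-- TTRL-lite variant V2522 (small cases `n ≤ 2` and `A.card = 3` combined) of the shortening
step of `stmt-CriticalPhenomena-4574`.  The two side conditions are incompatible: a finset
`A : Finset (Fin n)` has `A.card ≤ Fintype.card (Fin n) = n ≤ 2 < 3`, so the statement holds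
vacuously (same argument as the sibling variant V2396, hypotheses in the other order). -/
theorem stub_shorteningStep_var2522 :
    ∀ (n : ℕ) (w : Sym2 (Fin n) → unitInterval) (A : Finset (Fin n)) (b v x a₀ : Fin n), n ≤ 2 → A.card = 3 → v ∉ A → v ≠ x → w s(v, x) = 0 → a₀ ∈ A → (∀ a ∈ A, (prodBernoulli w).real (openConn a₀ b) ≤ (prodBernoulli w).real (openConn a b)) → (∀ w' : Sym2 (Fin n) → unitInterval, (∀ e, w e = 0 → w' e = 0) → ∀ (A' : Finset (Fin n)) (o' b' : Fin n) (t : ℝ), (∀ a ∈ A', t ≤ (prodBernoulli w').real (openConn a b')) → (prodBernoulli w').real (⋃ a ∈ A', openConn o' a) * t ≤ (prodBernoulli w').real (openConn o' b')) → (prodBernoulli (Function.update w s(v, x) 1)).real (⋃ a ∈ A, openConn v a) * (prodBernoulli (Function.update w s(v, x) 1)).real (openConn a₀ b) ≤ (prodBernoulli (Function.update w s(v, x) 1)).real (openConn v b) := by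
  intro n w A b v x a₀ hn hcard
  -- `A ⊆ Fin n` has at most `n ≤ 2` elements, contradicting `A.card = 3`
  have hle : A.card ≤ Fintype.card (Fin n) := Finset.card_le_univ A
  rw [Fintype.card_fin] at hle
  omega

end Summit.CriticalPhenomena.PercolationContinuityZ3.Theorems
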